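import Summits.CriticalPhenomena.PercolationContinuityZ3.Theorems.Transplant.KNCellsProcess
import Summits.CriticalPhenomena.PercolationContinuityZ3.Theorems.Transplant.KNLevelsStepIV
import Literature.Probability.LatticeModels.ProdBernoulliCoupling
import Literature.Probability.Percolation.KozmaNitzanPreFKG
import HarnessLib

/-!
# F8 (generic) — (32) at the ROOT CELL (hypothesis `hQ0` of `samePWitnessAt_of_cells` / `samePWitnessAt_of_cellKit`) from a plain hittability
# statement: with all edges of the root cube wired open, reaching `M_x` of the first neighbour inside `Q_0 ∪ E_{0,x}` is at least as likely as
# linking a source set inside `Q_0` to `M_x` inside `Q_0 ∪ E_{0,x}` under `P_p` (generalises `KozmaNitzan.KSch.hQ0_of_hit`, L/KozmaNitzanTheorem6 l. 1018)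

builds on p205010 (kernel theorem, internal audit signed; external expert review pending) — nothing in this file uses p205010.
Lane `prim-bschramm`, seat `prim-bschramm-p2` (task F8); helper file (`--supports stmt-CriticalPhenomena-4575`).

* `RootConn Γ` — the root cube is connected through `G` inside itself (instance fact: a graph ball times a planar box);
* **`hQ0_of_link`** — if `1 - δc < P_p(S₀ ↔ M_{a₀}(x) inside Q_{a₀}(0) ∪ E_{0,x})` for some `S₀ ⊆ Q_{a₀}(0)` (`KNLevels.linkIn`), then `hQ0` holds in
  direction `du`: under the graph weighting pinned open on `U₀ = E(Q_0)` the root is joined to every vertex of `Q_0` and the link event is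
  increasing (monotone coupling `prodBernoulli_real_mono_of_isUpperSet`).
[cite: KozmaNitzan2024, §4 p. 27 ((32) for the first step: "declare all edges of Q_0 open") — the ℤ^d model] [cite: GrimmettPercolation1999, §2.1]
-/

noncomputable section

open MeasureTheory ProbabilityTheory
open scoped ENNReal Classical

namespace Summit.CriticalPhenomena.PercolationContinuityZ3.Theorems

namespace Transplant

namespace KNCells

open Literature.Probability.Percolation Literature.Probability.LatticeModels SimpleGraph GadgetSystem ProbeHistory HSiteScheme Contour

variable {V : Type*} [DecidableEq V]

/-- **The root cube is connected through `G` inside itself.** [folklore] -/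
def RootConn {A : Type*} (G : SimpleGraph V) (Γ : CellGeom V A) : Prop :=
  ∀ y ∈ Γ.Q Γ.a₀ 0, PathIn G (↑(Γ.Q Γ.a₀ 0) : Set V) Γ.root y

namespace KSchA

variable {A : Type*} {G : SimpleGraph V} [G.LocallyFinite] {S : KSchA V A}

/-- **(32) at the root cell from hittability** (KN p. 27 for the first step): if some source set `S₀ ⊆ Q_0` is linked to `M_x` inside
`Q_0 ∪ E_{0,x}` with `P_p`-probability `> 1 - δc`, then under the weighting with `U₀ = E(Q_0)` wired open the root is joined to `M_x` inside
`Q_0 ∪ E_{0,x}` with probability `> 1 - δc`. [cite: KozmaNitzan2024, §4 p. 27 ((32), first step)] -/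
theorem hQ0_of_link (hconn : RootConn G S.Γ) (du : MDir) {S₀ : Finset V} (hS₀ : S₀ ⊆ S.Γ.Q S.Γ.a₀ 0)
    (hlink : 1 - S.δc < (bondPercolation G S.p).real
      (KNLevels.linkIn (↑(S.Γ.Q S.Γ.a₀ 0 ∪ S.Γ.Ewv S.Γ.a₀ 0 du) : Set V) S₀ (S.Γ.M S.Γ.a₀ ((0 : Site 2) + stepVec du)))) :
    1 - S.δc < (prodBernoulli (pinW (KNLevels.lattW G S.p) ↑(S.U₀ G) ↑(S.U₀ G))).real
      (⋃ t ∈ (↑(S.Γ.M S.Γ.a₀ ((0 : Site 2) + stepVec du)) : Set V),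
        openConnIn (↑(S.Γ.Q S.Γ.a₀ 0 ∪ S.Γ.Ewv S.Γ.a₀ 0 du) : Set V) S.Γ.root t) := by
  set Q₀ := S.Γ.Q S.Γ.a₀ 0 with hQ₀
  set U : Finset V := Q₀ ∪ S.Γ.Ewv S.Γ.a₀ 0 du with hU
  set E1 := KNLevels.linkIn (↑U : Set V) S₀ (S.Γ.M S.Γ.a₀ ((0 : Site 2) + stepVec du)) with hE1
  have hE1up : IsUpperSet E1 := by
    rw [hE1, KNLevels.linkIn_eq_biUnion]
    exact isUpperSet_iUnion₂ fun s _ => isUpperSet_iUnion₂ fun t _ => isUpperSet_openConnIn _ s t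
  have hE1m : MeasurableSet E1 := KNLevels.measurableSet_linkIn _ _ _
  have hle : KNLevels.lattW G S.p ≤ pinW (KNLevels.lattW G S.p) ↑(S.U₀ G) ↑(S.U₀ G) := by
    intro x
    by_cases hx : x ∈ (↑(S.U₀ G) : Set (Sym2 V))
    · rw [pinW_apply_of_mem_of_mem _ hx hx]; exact le_top
    · rw [pinW_apply_of_not_mem _ _ hx]
  have h1 : (bondPercolation G S.p).real E1 ≤ (prodBernoulli (pinW (KNLevels.lattW G S.p) ↑(S.U₀ G) ↑(S.U₀ G))).real E1 := by
    rw [← KNLevels.prodBernoulli_lattW]; exact prodBernoulli_real_mono_of_isUpperSet hle hE1up hE1m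
  have h2 : (prodBernoulli (pinW (KNLevels.lattW G S.p) ↑(S.U₀ G) ↑(S.U₀ G))).real E1 =
      (prodBernoulli (pinW (KNLevels.lattW G S.p) ↑(S.U₀ G) ↑(S.U₀ G))).real
        (E1 ∩ localCylinder (↑(S.U₀ G) : Set (Sym2 V)) ↑(S.U₀ G)) :=
    (prodBernoulli_pinW_real_inter_localCylinder _ (S.U₀ G).finite_toSet.countable _ E1).symm
  have h3 : E1 ∩ localCylinder (↑(S.U₀ G) : Set (Sym2 V)) ↑(S.U₀ G) ⊆
      ⋃ t ∈ (↑(S.Γ.M S.Γ.a₀ ((0 : Site 2) + stepVec du)) : Set V), openConnIn (↑U : Set V) S.Γ.root t := by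
    rintro η ⟨hη, hcyl⟩
    obtain ⟨s, hs, t, ht, hst⟩ := KNLevels.mem_linkIn_iff.1 hη
    simp only [Set.mem_iUnion, exists_prop]
    refine ⟨t, Finset.mem_coe.2 ht, ?_⟩
    have hU₀open : ∀ x ∈ S.U₀ G, x ∈ η := fun x hx => (hcyl x (Finset.mem_coe.2 hx)).2 (Finset.mem_coe.2 hx)
    -- the root is joined to `s` through the wired cube
    have h0s : η ∈ openConnIn (↑U : Set V) S.Γ.root s := by
      rw [DCT16.mem_openConnIn_iff_pathIn]
      have hp := hconn s (hS₀ hs)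
      refine (DCT16.pathIn_congrGraph (fun x y hx hy hxy => ?_) hp).mono (Finset.coe_subset.2 Finset.subset_union_left)
      rw [openGraph_adj]
      refine ⟨hU₀open _ ?_, hxy.ne⟩
      rw [U₀, mem_edgesIn_iff]
      refine ⟨(SimpleGraph.mem_edgeSet _).2 hxy, fun z hz => ?_⟩
      rcases Sym2.mem_iff.1 hz with rfl | rfl
      · exact Finset.mem_coe.1 hx
      · exact Finset.mem_coe.1 hy
    exact KNPreFKG.openConnIn_trans h0s hst
  calc 1 - S.δc < (bondPercolation G S.p).real E1 := hlink
    _ ≤ _ := h1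
    _ = _ := h2
    _ ≤ _ := measureReal_mono h3 (measure_ne_top _ _)

end KSchA

end KNCells

end Transplant

end Summit.CriticalPhenomena.PercolationContinuityZ3.Theorems

end
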